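import Summits.NavierStokesRegularity.NavierStokesRegularity.Theorems.HodographBetchovFastClassSqueezeMiddleStrainWeyl
import Literature.Analysis.FluidPDE.LocalTypeI

/-!
# `FastClassSqueeze` (stmt-NavierStokesRegularity-15832): the open stub of line `Sketch-ideasK1` is the `q ≥ 3`
# window of the crux (converse of the line's transfer)

Line `Sketch-ideasK1` (idea `resolved-weyl-split`) of crux 3 of route `HodographBetchov` reduces the crux to ONE
open registered stub, `stub_pointSubscaleSqueeze`: along every flow of the crux, an exponent `q ≥ 3` and, at every
backward-singular point `(T, x₀)`, a germ `(τ,T) × B_r(x₀)` (`0 ≤ τ`), a level `l > 0` and a resolution `R > 0`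
with a finite Miller functional of the SUBSCALE middle principal strain `λ₂(∇u − A_R)⁺`,
`A_R(t,x) = ⨍_{B̄_R(x)} ∇u(t)`, of the fast fluid (skeleton `Cruxes/FastClassSqueeze/Lines/Sketch_ideasK1.lean`;
the two other stubs are landed: `GermWeyl.stub_pointSqueeze_of_subscale`, `GermWeyl.stub_germ_of_pointSqueeze`).

This file proves the CONVERSE transfer, so that the residual is certified slack-free:

* `pointSubscaleSqueeze_of_window` — for one flow: the crux's conclusion with an exponent `q ≥ 3` (a level
  `l > 0`, a nonnegative min–max majorant `m` on the fast class, `∫₀ᵀ(∫_{F_l} m^q)^{2/(2q−3)} < ∞`) implies, on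
  EVERY ball `B_r(x₀)` and at EVERY resolution `R`, finiteness of the subscale functional over `(0,T)`:
  `λ₂(∇u − A_R) ≤ λ₂(∇u) + ‖A_R‖ ≤ m + ‖A_R‖` at fast points (Weyl, `GermWeyl.middleStrain_le_middleStrain_sub_add_opNorm`,
  and Courant–Fischer `middleStrain_le_iff`), `(a+b)^q ≤ 2^{q−1}(a^q + b^q)`, the resolved half is a-priori finite
  for `q ≥ 3` (B2, `WeylSplit.resolved_rpow_le`), and the integrals split along the measurable resolved summand
  exactly as in `WeylSplit.fastClassSqueeze_of_subscaleSqueeze`;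
* `pointSubscaleSqueeze_of_fastClassSqueezeWindow` — packaged in the shape of the registered stub: the `q ≥ 3`
  window of `FastClassSqueeze` implies `stub_pointSubscaleSqueeze` (with `r = R = 1`, `τ = 0`).

Together with the skeleton (stub ⇒ crux, keeping `q`), the open stub is EQUIVALENT to the `q ≥ 3` window of the
crux: the line's localisation (germs of the compact `ℋ¹`-null `Σ_T`) and Weyl split lose nothing and gain no
a-priori currency — the residual is the crux itself at a singular germ (regularity-strength in the fast biaxial
Type-I regime, cf. `Cruxes/FastClassSqueeze/Disproof.lean` §5).
-/

noncomputable section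

-- the summit and its single problem share the name `NavierStokesRegularity` (D-0017 nested layout)
set_option linter.dupNamespace false

namespace Summit.NavierStokesRegularity.NavierStokesRegularity.Theorems.FastClassSqueeze.GermWeyl

open Set MeasureTheory Filter Topology Metric Literature.Analysis.FluidPDE
open scoped ENNReal NNReal

/-- **Weyl the other way:** `λ₂(X − A) ≤ λ₂(X) + ‖A‖`. [cite: HornJohnson2013, Thm 4.3.1] -/
theorem middleStrain_sub_le_middleStrain_add_opNorm
    (X A : EuclideanSpace ℝ (Fin 3) →L[ℝ] EuclideanSpace ℝ (Fin 3)) :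
    strainEigenvalues ((X - A : EuclideanSpace ℝ (Fin 3) →L[ℝ] EuclideanSpace ℝ (Fin 3)) :
        EuclideanSpace ℝ (Fin 3) →ₗ[ℝ] EuclideanSpace ℝ (Fin 3)) finrank_euclideanSpace_fin 1 ≤
      strainEigenvalues ((X : EuclideanSpace ℝ (Fin 3) →L[ℝ] EuclideanSpace ℝ (Fin 3)) :
        EuclideanSpace ℝ (Fin 3) →ₗ[ℝ] EuclideanSpace ℝ (Fin 3)) finrank_euclideanSpace_fin 1 + ‖A‖ := by
  have h := middleStrain_le_middleStrain_sub_add_opNorm (X - A) (-A)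
  rwa [sub_neg_eq_add, sub_add_cancel, norm_neg] at h

/-- **Pointwise: the clipped subscale middle strain under a min–max bound `m` for `∇u`.** If the quadratic form
of `X` on some orthonormal 2-frame is `≤ m (α² + β²)` with `m ≥ 0`, then for `q ≥ 1`
`(ofReal λ₂(X − A))^q ≤ 2^{q−1} ((ofReal m)^q + (ofReal ‖A‖)^q)`. [cite: HornJohnson2013, Thm 4.3.1] -/
theorem ofReal_middleStrain_sub_rpow_le_of_clause
    (X A : EuclideanSpace ℝ (Fin 3) →L[ℝ] EuclideanSpace ℝ (Fin 3)) {m q : ℝ} (hm : 0 ≤ m) (hq : 1 ≤ q)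
    (hcl : ∃ v w : EuclideanSpace ℝ (Fin 3), ‖v‖ = 1 ∧ ‖w‖ = 1 ∧ inner ℝ v w = 0 ∧
      ∀ α β : ℝ, inner ℝ (X (α • v + β • w)) (α • v + β • w) ≤ m * (α ^ 2 + β ^ 2)) :
    ENNReal.ofReal (strainEigenvalues
        ((X - A : EuclideanSpace ℝ (Fin 3) →L[ℝ] EuclideanSpace ℝ (Fin 3)) :
          EuclideanSpace ℝ (Fin 3) →ₗ[ℝ] EuclideanSpace ℝ (Fin 3)) finrank_euclideanSpace_fin 1) ^ q ≤
      (2 : ℝ≥0∞) ^ (q - 1) * (ENNReal.ofReal m ^ q + ENNReal.ofReal ‖A‖ ^ q) := by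
  have hX : strainEigenvalues ((X : EuclideanSpace ℝ (Fin 3) →L[ℝ] EuclideanSpace ℝ (Fin 3)) :
      EuclideanSpace ℝ (Fin 3) →ₗ[ℝ] EuclideanSpace ℝ (Fin 3)) finrank_euclideanSpace_fin 1 ≤ m :=
    (middleStrain_le_iff X m).2 hcl
  have h1 : ENNReal.ofReal (strainEigenvalues
        ((X - A : EuclideanSpace ℝ (Fin 3) →L[ℝ] EuclideanSpace ℝ (Fin 3)) :
          EuclideanSpace ℝ (Fin 3) →ₗ[ℝ] EuclideanSpace ℝ (Fin 3)) finrank_euclideanSpace_fin 1) ≤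
      ENNReal.ofReal m + ENNReal.ofReal ‖A‖ := by
    rw [← ENNReal.ofReal_add hm (norm_nonneg _)]
    exact ENNReal.ofReal_le_ofReal
      ((middleStrain_sub_le_middleStrain_add_opNorm X A).trans (by linarith))
  exact (ENNReal.rpow_le_rpow h1 (by linarith)).trans (ENNReal.rpow_add_le_mul_rpow_add_rpow _ _ hq)

/-- **Converse transfer on a window, one flow, one ball: crux data with `q ≥ 3` ⇒ finite subscale functional.**
Along a classical solution of unforced Navier–Stokes on `ℝ³ × [0,T)` that is Leray–Hopf from `u 0`: if a
nonnegative `m` majorises the middle principal strain in min–max form on the fast class `{l < |u|}` (`l > 0`) and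
`∫₀ᵀ (∫_{F_l(t)} m^q)^{2/(2q−3)} < ∞` for some `q ≥ 3`, then for every centre `x₀`, radius `r` and resolution
`R` the Miller functional of the subscale middle strain `λ₂(∇u − ⨍_{B̄_R(x)}∇u(t))⁺` over
`(0,T) × (F_l(t) ∩ B_r(x₀))` is finite (Weyl + B2 + the splitting bookkeeping of the landed transfer).
[cite: Constantin1990, §2 eq. (2.21)] -/
theorem pointSubscaleSqueeze_of_window {ν T : ℝ} (hν : 0 < ν) (hT : 0 < T)
    {u : ℝ → EuclideanSpace ℝ (Fin 3) → EuclideanSpace ℝ (Fin 3)} {p : ℝ → EuclideanSpace ℝ (Fin 3) → ℝ}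
    (hcl : IsClassicalNSSolutionOn (Ico 0 T) ν 0 u p) (hLH : IsLerayHopfOn T ν 0 (u 0) u)
    {l q : ℝ} (hl : 0 < l) (hq : 3 ≤ q) {m : ℝ → EuclideanSpace ℝ (Fin 3) → ℝ} (hm0 : ∀ t x, 0 ≤ m t x)
    (hclause : ∀ t ∈ Ico 0 T, ∀ x, l < ‖u t x‖ → ∃ v w : EuclideanSpace ℝ (Fin 3),
      ‖v‖ = 1 ∧ ‖w‖ = 1 ∧ inner ℝ v w = 0 ∧
      ∀ α β : ℝ, inner ℝ (fderiv ℝ (u t) x (α • v + β • w)) (α • v + β • w) ≤ m t x * (α ^ 2 + β ^ 2))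
    (hint : ∫⁻ t in Ioo 0 T, (∫⁻ x in {x : EuclideanSpace ℝ (Fin 3) | l < ‖u t x‖},
      ENNReal.ofReal (m t x) ^ q) ^ (2 / (2 * q - 3)) < ⊤)
    (x₀ : EuclideanSpace ℝ (Fin 3)) (r R : ℝ) :
    ∫⁻ t in Ioo 0 T, (∫⁻ x in {x : EuclideanSpace ℝ (Fin 3) | l < ‖u t x‖} ∩ ball x₀ r,
      ENNReal.ofReal (strainEigenvalues
        ((fderiv ℝ (u t) x - ⨍ y in closedBall x R, fderiv ℝ (u t) y :
            EuclideanSpace ℝ (Fin 3) →L[ℝ] EuclideanSpace ℝ (Fin 3)) :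
          EuclideanSpace ℝ (Fin 3) →ₗ[ℝ] EuclideanSpace ℝ (Fin 3))
        finrank_euclideanSpace_fin 1) ^ q) ^ (2 / (2 * q - 3)) < ⊤ := by
  -- ### the a-priori data: B2, the dissipation bound, the measurable dissipation slice
  obtain ⟨K, hKtop, hK⟩ := WeylSplit.resolved_rpow_le hν.le hcl hLH R hl hq
  obtain ⟨hGfin, -⟩ := hLH.lintegral_frobeniusNormSq_fderiv_of_classical hcl hT
  obtain ⟨Gm, hGm, hGm_eq⟩ := WeylSplit.exists_measurable_dissipation_slice hcl
  -- notation: the resolved gradient and the outer exponent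
  set A : ℝ → EuclideanSpace ℝ (Fin 3) → (EuclideanSpace ℝ (Fin 3) →L[ℝ] EuclideanSpace ℝ (Fin 3)) :=
    fun t x => ⨍ y in closedBall x R, fderiv ℝ (u t) y with hA
  have hq1 : 1 ≤ q := by linarith
  set e : ℝ := 2 / (2 * q - 3) with he
  have h2q3 : 0 < 2 * q - 3 := by linarith
  have he0 : 0 ≤ e := by rw [he]; exact div_nonneg zero_le_two h2q3.le
  have he1 : e ≤ 1 := by rw [he, div_le_one h2q3]; linarith
  set C₂ : ℝ≥0∞ := ((2 : ℝ≥0∞) ^ (q - 1)) ^ e with hC₂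
  have hC₂top : C₂ ≠ ⊤ :=
    ENNReal.rpow_ne_top_of_nonneg he0 (ENNReal.rpow_ne_top_of_nonneg (by linarith) ENNReal.ofNat_ne_top)
  -- ### pointwise in time: `(∫_S (λ₂,sub⁺)^q)^e ≤ C₂ ((∫_S m^q)^e + K (1 + Gm t))`
  have hpt : ∀ t ∈ Ioo 0 T,
      (∫⁻ x in {x : EuclideanSpace ℝ (Fin 3) | l < ‖u t x‖} ∩ ball x₀ r,
          ENNReal.ofReal (strainEigenvalues
            ((fderiv ℝ (u t) x - A t x : EuclideanSpace ℝ (Fin 3) →L[ℝ] EuclideanSpace ℝ (Fin 3)) :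
              EuclideanSpace ℝ (Fin 3) →ₗ[ℝ] EuclideanSpace ℝ (Fin 3))
            finrank_euclideanSpace_fin 1) ^ q) ^ e ≤
        C₂ * ((∫⁻ x in {x : EuclideanSpace ℝ (Fin 3) | l < ‖u t x‖} ∩ ball x₀ r,
          ENNReal.ofReal (m t x) ^ q) ^ e + K * (1 + Gm t)) := by
    intro t ht
    have ht' : t ∈ Ico 0 T := Ioo_subset_Ico_self ht
    set S : Set (EuclideanSpace ℝ (Fin 3)) := {x | l < ‖u t x‖} ∩ ball x₀ r with hS
    have hSm : MeasurableSet S := (measurableSet_fast hcl ht' l).inter measurableSet_ball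
    -- measurability of the resolved integrand in `x`
    have hsmooth : ContDiff ℝ 1 (u t) := (hcl.contDiff_velocity ht').of_le (by norm_cast)
    have hAcont : Continuous (A t) := by
      rw [hA]
      exact WeylSplit.continuous_setAverage_closedBall (hsmooth.continuous_fderiv one_ne_zero) R
    have hAmeas : AEMeasurable (fun x => ENNReal.ofReal ‖A t x‖ ^ q) (volume.restrict S) :=
      ((hAcont.norm.measurable.ennreal_ofReal).pow_const q).aemeasurable
    -- split the inner integral (pointwise Weyl + the clause at fast points, then additivity)
    have hinner : (∫⁻ x in S, ENNReal.ofReal (strainEigenvalues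
          ((fderiv ℝ (u t) x - A t x : EuclideanSpace ℝ (Fin 3) →L[ℝ] EuclideanSpace ℝ (Fin 3)) :
            EuclideanSpace ℝ (Fin 3) →ₗ[ℝ] EuclideanSpace ℝ (Fin 3)) finrank_euclideanSpace_fin 1) ^ q) ≤
        (2 : ℝ≥0∞) ^ (q - 1) * ((∫⁻ x in S, ENNReal.ofReal (m t x) ^ q) +
          ∫⁻ x in S, ENNReal.ofReal ‖A t x‖ ^ q) := by
      calc (∫⁻ x in S, ENNReal.ofReal (strainEigenvalues
            ((fderiv ℝ (u t) x - A t x : EuclideanSpace ℝ (Fin 3) →L[ℝ] EuclideanSpace ℝ (Fin 3)) :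
              EuclideanSpace ℝ (Fin 3) →ₗ[ℝ] EuclideanSpace ℝ (Fin 3)) finrank_euclideanSpace_fin 1) ^ q)
          ≤ ∫⁻ x in S, (2 : ℝ≥0∞) ^ (q - 1) * (ENNReal.ofReal (m t x) ^ q + ENNReal.ofReal ‖A t x‖ ^ q) :=
            setLIntegral_mono' hSm fun x hx =>
              ofReal_middleStrain_sub_rpow_le_of_clause _ _ (hm0 t x) hq1 (hclause t ht' x hx.1)
        _ = (2 : ℝ≥0∞) ^ (q - 1) * ((∫⁻ x in S, ENNReal.ofReal (m t x) ^ q) +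
              ∫⁻ x in S, ENNReal.ofReal ‖A t x‖ ^ q) := by
            rw [lintegral_const_mul' _ _ (ENNReal.rpow_ne_top_of_nonneg (by linarith)
              ENNReal.ofNat_ne_top), lintegral_add_right' _ hAmeas]
    -- the resolved half: local `≤` global, raised to the power `e`, bounded by B2
    have hres : (∫⁻ x in S, ENNReal.ofReal ‖A t x‖ ^ q) ^ e ≤ K * (1 + Gm t) := by
      calc (∫⁻ x in S, ENNReal.ofReal ‖A t x‖ ^ q) ^ e
          ≤ (∫⁻ x in {x : EuclideanSpace ℝ (Fin 3) | l < ‖u t x‖}, ENNReal.ofReal ‖A t x‖ ^ q) ^ e :=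
            ENNReal.rpow_le_rpow (lintegral_mono_set inter_subset_left) he0
        _ ≤ K * (1 + ∫⁻ y, ENNReal.ofReal (frobeniusNormSq (fderiv ℝ (u t) y))) := hK t ht'
        _ = K * (1 + Gm t) := by rw [hGm_eq t ht]
    calc (∫⁻ x in S, ENNReal.ofReal (strainEigenvalues
          ((fderiv ℝ (u t) x - A t x : EuclideanSpace ℝ (Fin 3) →L[ℝ] EuclideanSpace ℝ (Fin 3)) :
            EuclideanSpace ℝ (Fin 3) →ₗ[ℝ] EuclideanSpace ℝ (Fin 3)) finrank_euclideanSpace_fin 1) ^ q) ^ e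
        ≤ ((2 : ℝ≥0∞) ^ (q - 1) * ((∫⁻ x in S, ENNReal.ofReal (m t x) ^ q) +
            ∫⁻ x in S, ENNReal.ofReal ‖A t x‖ ^ q)) ^ e := ENNReal.rpow_le_rpow hinner he0
      _ = C₂ * ((∫⁻ x in S, ENNReal.ofReal (m t x) ^ q) + ∫⁻ x in S, ENNReal.ofReal ‖A t x‖ ^ q) ^ e := by
          rw [ENNReal.mul_rpow_of_nonneg _ _ he0, hC₂]
      _ ≤ C₂ * ((∫⁻ x in S, ENNReal.ofReal (m t x) ^ q) ^ e + (∫⁻ x in S, ENNReal.ofReal ‖A t x‖ ^ q) ^ e) :=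
          mul_le_mul_right (ENNReal.rpow_add_le_add_rpow _ _ he0 he1) _
      _ ≤ C₂ * ((∫⁻ x in S, ENNReal.ofReal (m t x) ^ q) ^ e + K * (1 + Gm t)) :=
          mul_le_mul_right (add_le_add le_rfl hres) _
  -- ### integrate in time over `(0,T)`
  have hmaj : AEMeasurable (fun t => K * (1 + Gm t)) (volume.restrict (Ioo 0 T)) :=
    ((hGm.const_add 1).const_mul K).aemeasurable
  have hle : ∫⁻ t in Ioo 0 T, (∫⁻ x in {x : EuclideanSpace ℝ (Fin 3) | l < ‖u t x‖} ∩ ball x₀ r,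
        ENNReal.ofReal (strainEigenvalues
          ((fderiv ℝ (u t) x - A t x : EuclideanSpace ℝ (Fin 3) →L[ℝ] EuclideanSpace ℝ (Fin 3)) :
            EuclideanSpace ℝ (Fin 3) →ₗ[ℝ] EuclideanSpace ℝ (Fin 3))
          finrank_euclideanSpace_fin 1) ^ q) ^ e ≤
      ∫⁻ t in Ioo 0 T, C₂ * ((∫⁻ x in {x : EuclideanSpace ℝ (Fin 3) | l < ‖u t x‖} ∩ ball x₀ r,
        ENNReal.ofReal (m t x) ^ q) ^ e + K * (1 + Gm t)) := by
    refine lintegral_mono_ae ?_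
    filter_upwards [ae_restrict_mem measurableSet_Ioo] with t ht
    exact hpt t ht
  refine lt_of_le_of_lt hle ?_
  rw [lintegral_const_mul' _ _ hC₂top, lintegral_add_right' _ hmaj]
  refine ENNReal.mul_lt_top hC₂top.lt_top (ENNReal.add_lt_top.2 ⟨?_, ?_⟩)
  · -- the `m` half: local `≤` global, finite by hypothesis
    refine lt_of_le_of_lt (lintegral_mono fun t => ?_) hint
    exact ENNReal.rpow_le_rpow (lintegral_mono_set inter_subset_left) he0
  · -- the resolved majorant is integrable: `K (T + ∫₀ᵀ∫ |∇u|²_F) < ∞`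
    have hGm_int : ∫⁻ t in Ioo 0 T, Gm t =
        ∫⁻ t in Ioo 0 T, ∫⁻ y, ENNReal.ofReal (frobeniusNormSq (fderiv ℝ (u t) y)) :=
      setLIntegral_congr_fun measurableSet_Ioo hGm_eq
    rw [lintegral_const_mul' _ _ hKtop, lintegral_add_left measurable_const, lintegral_const,
      Measure.restrict_apply_univ, Real.volume_Ioo, hGm_int]
    refine ENNReal.mul_lt_top hKtop.lt_top ?_
    exact ENNReal.add_lt_top.2 ⟨by rw [one_mul]; exact ENNReal.ofReal_lt_top, hGfin.lt_top⟩

/-- **The `q ≥ 3` window of `FastClassSqueeze` implies the line's open stub `stub_pointSubscaleSqueeze`**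
(packaged in the registered shape: `r = R = 1`, `τ = 0`, the crux's own `l` and `q`; the restriction to
backward-singular centres is not even needed). With the skeleton's transfer (stub ⇒ crux, same `q`) the open stub
is therefore EQUIVALENT to the `q ≥ 3` window of the crux. [cite: Miller2019, Thm 1.1] -/
theorem pointSubscaleSqueeze_of_fastClassSqueezeWindow :
    (∀ (ν T : ℝ), 0 < ν → 0 < T →
      ∀ (u : ℝ → EuclideanSpace ℝ (Fin 3) → EuclideanSpace ℝ (Fin 3)) (p : ℝ → EuclideanSpace ℝ (Fin 3) → ℝ),
      Literature.Analysis.FluidPDE.IsClassicalNSSolutionOn (Set.Ico 0 T) ν 0 u p →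
      Literature.Analysis.FluidPDE.IsLerayHopfOn T ν 0 (u 0) u →
      Literature.Analysis.FluidPDE.HasRapidSpatialDecay (u 0) →
      ∃ l : ℝ, 0 < l ∧ ∃ q : ℝ, 3 ≤ q ∧ ∃ m : ℝ → EuclideanSpace ℝ (Fin 3) → ℝ, (∀ t x, 0 ≤ m t x) ∧
        (∀ t ∈ Set.Ico 0 T, ∀ x, l < ‖u t x‖ → ∃ v w : EuclideanSpace ℝ (Fin 3),
          ‖v‖ = 1 ∧ ‖w‖ = 1 ∧ inner ℝ v w = 0 ∧
          ∀ α β : ℝ, inner ℝ (fderiv ℝ (u t) x (α • v + β • w)) (α • v + β • w) ≤ m t x * (α ^ 2 + β ^ 2)) ∧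
        ∫⁻ t in Set.Ioo 0 T, (∫⁻ x in {x : EuclideanSpace ℝ (Fin 3) | l < ‖u t x‖},
          ENNReal.ofReal (m t x) ^ q) ^ (2 / (2 * q - 3)) < ⊤) →
    ∀ (ν T : ℝ), 0 < ν → 0 < T →
      ∀ (u : ℝ → EuclideanSpace ℝ (Fin 3) → EuclideanSpace ℝ (Fin 3)) (p : ℝ → EuclideanSpace ℝ (Fin 3) → ℝ),
      Literature.Analysis.FluidPDE.IsClassicalNSSolutionOn (Set.Ico 0 T) ν 0 u p →
      Literature.Analysis.FluidPDE.IsLerayHopfOn T ν 0 (u 0) u →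
      Literature.Analysis.FluidPDE.HasRapidSpatialDecay (u 0) →
      ∃ q : ℝ, 3 ≤ q ∧ ∀ x₀ : EuclideanSpace ℝ (Fin 3),
        Literature.Analysis.FluidPDE.IsBackwardSingularPoint u (T, x₀) →
        ∃ r : ℝ, 0 < r ∧ ∃ R : ℝ, 0 < R ∧ ∃ τ : ℝ, 0 ≤ τ ∧ τ < T ∧ ∃ l : ℝ, 0 < l ∧
          ∫⁻ t in Set.Ioo τ T, (∫⁻ x in {x : EuclideanSpace ℝ (Fin 3) | l < ‖u t x‖} ∩ Metric.ball x₀ r,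
            ENNReal.ofReal (Literature.Analysis.FluidPDE.strainEigenvalues
              ((fderiv ℝ (u t) x - ⨍ y in Metric.closedBall x R, fderiv ℝ (u t) y :
                  EuclideanSpace ℝ (Fin 3) →L[ℝ] EuclideanSpace ℝ (Fin 3)) :
                EuclideanSpace ℝ (Fin 3) →ₗ[ℝ] EuclideanSpace ℝ (Fin 3))
              finrank_euclideanSpace_fin 1) ^ q) ^ (2 / (2 * q - 3)) < ⊤ := by
  intro hwin ν T hν hT u p hcl hLH hdec
  obtain ⟨l, hl, q, hq, m, hm0, hclause, hint⟩ := hwin ν T hν hT u p hcl hLH hdec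
  refine ⟨q, hq, fun x₀ _ => ⟨1, one_pos, 1, one_pos, 0, le_rfl, hT, l, hl, ?_⟩⟩
  exact pointSubscaleSqueeze_of_window hν hT hcl hLH hl hq hm0 hclause hint x₀ 1 1

end Summit.NavierStokesRegularity.NavierStokesRegularity.Theorems.FastClassSqueeze.GermWeyl

end
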